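import Summits.ValiantsHypothesis.ValiantsHypothesis.Theorems.NewtonUnitEquationsTwoProductsConfinedTameLawLift
import HarnessLib

/-!
# R10 (`positive-circuit-chart`) — ENGINE F4a: FIBRES of the chart lift as finsets
For chart data `Ch : R10.ChartData u v` and an upstairs exponent `x`, the fibre `Ch.Fib x` = all letter vectors `κ` with
`piT M κ = x` (a finset: `κ k ≤ x a` for an atom `a` of the letter `k`); the upstairs coefficient of any lifted series is the
fibre sum of the downstairs coefficients; fibre elements have degree `≤ deg x`; two fibre elements differ by a SATURATED
`Λ`-vector and conversely (`hker`); under LETTER-CONFINEMENT of `Λ` to an index set `Lι` all fibre elements agree off `Lι`.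
R275 P3 scope: tool for the proper positive sub-case rung `ConfinedTameLaw`; nothing here closes 5906; VP ≠ VNP is NOT proved.
-/

noncomputable section
set_option linter.dupNamespace false
set_option linter.unusedSectionVars false

namespace Summit.ValiantsHypothesis.ValiantsHypothesis.Theorems.NewtonUnitEquations.TwoProducts.PermutationType
namespace R10
open scoped BigOperators
open MvPolynomial
open Summit.ValiantsHypothesis.ValiantsHypothesis.Theorems.NewtonUnitEquations.TwoProducts.FormalLogLinearisation
open Summit.ValiantsHypothesis.ValiantsHypothesis.Theorems.NewtonUnitEquations.TwoProducts.PlanarCell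

section Fibres
variable {m : ℕ}
variable {u v : Fin m → MvPolynomial (Fin 2) ℂ}
variable (Ch : ChartData u v)

/-- An atom met by the letter `k`. [folklore] -/
def ChartData.atomOf (k : Fin (sE u v)) : Fin Ch.N := Classical.choose (Finsupp.ne_iff.mp (Ch.hM0 k))

/-- The chosen atom has a positive coordinate at `k`. [folklore] -/
theorem ChartData.atomOf_spec (k : Fin (sE u v)) : (Ch.M k) (Ch.atomOf k) ≠ 0 :=
  Classical.choose_spec (Finsupp.ne_iff.mp (Ch.hM0 k))

/-- Coordinates of the lift dominate the letters: `κ k ≤ (piT M κ) (atomOf k)`. [folklore] -/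
theorem ChartData.le_piT_atomOf (κ : Fin (sE u v) →₀ ℕ) (k : Fin (sE u v)) : κ k ≤ piT Ch.M κ (Ch.atomOf k) := by
  rw [piT_apply]
  have h1 : κ k * 1 ≤ κ k * (Ch.M k) (Ch.atomOf k) :=
    Nat.mul_le_mul_left _ (Nat.one_le_iff_ne_zero.mpr (Ch.atomOf_spec k))
  rw [mul_one] at h1
  exact h1.trans (Finset.single_le_sum (f := fun i => κ i * (Ch.M i) (Ch.atomOf k)) (fun i _ => Nat.zero_le _)
    (Finset.mem_univ k))

/-- **The fibre** of the lift over an upstairs exponent, as a finset. [folklore] -/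
def ChartData.Fib (x : Fin Ch.N →₀ ℕ) : Finset (Fin (sE u v) →₀ ℕ) :=
  ((Fintype.piFinset fun k => Finset.range (x (Ch.atomOf k) + 1)).image
    fun f => Finsupp.equivFunOnFinite.symm f).filter fun κ => piT Ch.M κ = x

/-- Membership in the fibre. [folklore] -/
theorem ChartData.mem_Fib (x : Fin Ch.N →₀ ℕ) (κ : Fin (sE u v) →₀ ℕ) : κ ∈ Ch.Fib x ↔ piT Ch.M κ = x := by
  unfold ChartData.Fib
  rw [Finset.mem_filter]
  constructor
  · exact fun h => h.2
  · intro h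
    refine ⟨Finset.mem_image.mpr ⟨⇑κ, Fintype.mem_piFinset.mpr fun k => Finset.mem_range.mpr ?_, by simp⟩, h⟩
    have := Ch.le_piT_atomOf κ k
    rw [h] at this
    omega

/-- **Upstairs coefficients are fibre sums.** [folklore] -/
theorem ChartData.coeff_phiT_eq_sum_Fib (H : MvPolynomial (Fin (sE u v)) ℂ) (x : Fin Ch.N →₀ ℕ) :
    coeff x (phiT Ch.M H) = ∑ κ ∈ Ch.Fib x, coeff κ H := by
  classical
  rw [coeff_phiT]
  -- both sides are sums of `coeff κ H` over `{κ : piT M κ = x}` restricted to / extended from the support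
  rw [← Finset.sum_filter_add_sum_filter_not (Ch.Fib x) (fun κ => κ ∈ H.support)]
  have h0 : ∑ κ ∈ (Ch.Fib x).filter (fun κ => κ ∉ H.support), coeff κ H = 0 :=
    Finset.sum_eq_zero fun κ hκ => by
      have := (Finset.mem_filter.mp hκ).2
      rwa [mem_support_iff, not_not] at this
  rw [h0, add_zero]
  refine Finset.sum_congr ?_ fun _ _ => rfl
  ext κ
  simp only [Finset.mem_filter, ChartData.mem_Fib]
  tauto

/-- Degree is additive-monotone under the lift: `deg κ ≤ deg (piT M κ)`. [folklore] -/
theorem ChartData.deg_le_deg_piT (κ : Fin (sE u v) →₀ ℕ) : deg κ ≤ deg (piT Ch.M κ) := by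
  classical
  unfold deg
  rw [Finsupp.sum_fintype _ _ (fun _ => rfl), Finsupp.sum_fintype _ _ (fun _ => rfl)]
  have hx : ∀ a, (piT Ch.M κ) a = ∑ k, κ k * (Ch.M k) a := fun a => piT_apply Ch.M κ a
  simp only [hx]
  rw [Finset.sum_comm]
  refine Finset.sum_le_sum fun k _ => ?_
  calc κ k ≤ κ k * (Ch.M k) (Ch.atomOf k) := by
        have := Nat.mul_le_mul_left (κ k) (Nat.one_le_iff_ne_zero.mpr (Ch.atomOf_spec k)); rwa [mul_one] at this
    _ ≤ ∑ a, κ k * (Ch.M k) a :=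
        Finset.single_le_sum (f := fun a => κ k * (Ch.M k) a) (fun a _ => Nat.zero_le _) (Finset.mem_univ _)

/-- Fibre elements have degree at most the degree of the upstairs point. [folklore] -/
theorem ChartData.deg_le_of_mem_Fib {x : Fin Ch.N →₀ ℕ} {κ : Fin (sE u v) →₀ ℕ} (h : κ ∈ Ch.Fib x) : deg κ ≤ deg x := by
  rw [ChartData.mem_Fib] at h; rw [← h]; exact Ch.deg_le_deg_piT κ

/-- **Two fibre elements differ by a saturated lattice vector.** [folklore] -/
theorem ChartData.sat_of_mem_Fib {x : Fin Ch.N →₀ ℕ} {κ κ' : Fin (sE u v) →₀ ℕ} (h : κ ∈ Ch.Fib x) (h' : κ' ∈ Ch.Fib x) :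
    ∃ k : ℕ, 0 < k ∧ (fun i => (k : ℤ) * (tableZ u v κ - tableZ u v κ') i) ∈ Ch.Λ := by
  rw [ChartData.mem_Fib] at h h'
  refine (Ch.hker _).1 fun a => ?_
  have e1 := congrArg (fun y : Fin Ch.N →₀ ℕ => (y a : ℤ)) (h.trans h'.symm)
  simp only [piT_apply, Nat.cast_sum, Nat.cast_mul] at e1
  simp only [Pi.sub_apply, tableZ, sub_mul, Finset.sum_sub_distrib, e1, sub_self]

/-- **Conversely**, a letter vector differing from a fibre element by a saturated lattice vector lies in the fibre. [folklore] -/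
theorem ChartData.mem_Fib_of_sat {x : Fin Ch.N →₀ ℕ} {κ κ' : Fin (sE u v) →₀ ℕ} (h : κ ∈ Ch.Fib x)
    (hs : ∃ k : ℕ, 0 < k ∧ (fun i => (k : ℤ) * (tableZ u v κ' - tableZ u v κ) i) ∈ Ch.Λ) : κ' ∈ Ch.Fib x := by
  rw [ChartData.mem_Fib] at h ⊢
  rw [← h]
  have hk := (Ch.hker _).2 hs
  ext a
  have h1 := hk a
  simp only [Pi.sub_apply, tableZ, sub_mul, Finset.sum_sub_distrib, sub_eq_zero] at h1
  rw [piT_apply, piT_apply]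
  exact_mod_cast h1

/-- LETTER-CONFINEMENT of the lattice to an index set. [folklore] -/
def ChartData.Confined (Lι : Finset (Fin (sE u v))) : Prop := ∀ z ∈ Ch.Λ, ∀ k, k ∉ Lι → z k = 0

/-- Under confinement, **fibre elements agree off `Lι`** (the free part of a fibre is well defined). [folklore] -/
theorem ChartData.apply_eq_of_mem_Fib {Lι : Finset (Fin (sE u v))} (hc : Ch.Confined Lι) {x : Fin Ch.N →₀ ℕ}
    {κ κ' : Fin (sE u v) →₀ ℕ} (h : κ ∈ Ch.Fib x) (h' : κ' ∈ Ch.Fib x) {k : Fin (sE u v)} (hk : k ∉ Lι) : κ k = κ' k := by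
  obtain ⟨n, hn, hmem⟩ := Ch.sat_of_mem_Fib h h'
  have h1 := hc _ hmem k hk
  simp only [Pi.sub_apply, tableZ] at h1
  rcases mul_eq_zero.1 h1 with h2 | h2
  · exact absurd (by exact_mod_cast h2 : n = 0) hn.ne'
  · have : (κ k : ℤ) = (κ' k : ℤ) := by linarith
    exact_mod_cast this

end Fibres

end R10
end Summit.ValiantsHypothesis.ValiantsHypothesis.Theorems.NewtonUnitEquations.TwoProducts.PermutationType

end
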